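import Mathlib

/-!
# Route BarrierLever — item `KRSTNoGoBelow12cOnB05` (stmt-ValiantsHypothesis-19340), part 1/6:
# short character sums on a simplex and the Gershgorin independence criterion

Lean text authored by the cell planner seat `valiant-natproofs-p2` (gen 3, HOME/CharSum-p2g3.lean =
HOME/RowZero-p2g3.lean v5 §CharSum, referee PASS), landed by the prover seat as the first helper of
the [B05]-conditional no-go band `b < 12c` for KRST's generator (memo ROUTE-MEMO-p2-g3 §4c–§4e).
Mathlib only. Newton's identity for complete homogeneous sums (`newton`) and the hockey-stick bound
**`norm_sum_simplex_le`** (`‖Σ_t z_t^i‖ ≤ K` for `1 ≤ i ≤ n` ⇒ `‖Σ_{|μ| ≤ n} z^μ‖ ≤ C(K+n, n)`);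
`linearIndependent_of_gram_dominant` (Gershgorin for Gram matrices); `chi e μ = Π_t ψ(e_t)^{μ_t}`
(`ψ = ZMod.stdAddChar`) and **`linearIndependent_chi`**: characters on the simplex with pairwise
uniform cancellation `‖Σ_t ψ(i (e'_t − e_t))‖ ≤ K` and `(|I| − 1)·C(K+n, n) < |simplex|` are linearly
independent. WHAT THIS IS NOT: no exponential-sum ESTIMATE is proved (Bourgain 2005 Thm 2 stays a
hypothesis of the later parts).
-/

-- layout Summits/ValiantsHypothesis/ValiantsHypothesis forces the duplicated namespace component
set_option linter.dupNamespace false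
noncomputable section

open Finset
namespace Summit.ValiantsHypothesis.ValiantsHypothesis.Theorems.BarrierLever.KRSTNoGoBelow12cOnB05.CharSum

variable {N : ℕ}

/-- The monomial `z^μ = Π_t z_t^{μ_t}`. -/
noncomputable def mono (z : Fin N → ℂ) (μ : Fin N → ℕ) : ℂ := ∏ t, z t ^ μ t

/-- Complete homogeneous sum of degree `d`. -/
noncomputable def hsum (z : Fin N → ℂ) (d : ℕ) : ℂ := ∑ μ ∈ Nat.antidiagonalTuple N d, mono z μ

/-- Power sum `P_i = Σ_t z_t^i`. -/
noncomputable def psum (z : Fin N → ℂ) (i : ℕ) : ℂ := ∑ t, z t ^ i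

/-- Weighted sum `W_t(d) = Σ_{|μ| = d} μ_t z^μ`. -/
noncomputable def wsum (z : Fin N → ℂ) (t : Fin N) (d : ℕ) : ℂ :=
  ∑ μ ∈ Nat.antidiagonalTuple N d, (μ t : ℂ) * mono z μ

/-- `z^0 = 1`. -/
theorem mono_zero (z : Fin N → ℂ) : mono z 0 = 1 := by simp [mono]

/-- `h_0 = 1`. -/
theorem hsum_zero (z : Fin N → ℂ) : hsum z 0 = 1 := by
  simp [hsum, Nat.antidiagonalTuple_zero_right, mono_zero]

/-- `W_t(0) = 0`. -/
theorem wsum_zero (z : Fin N → ℂ) (t : Fin N) : wsum z t 0 = 0 := by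
  simp [wsum, Nat.antidiagonalTuple_zero_right]

/-- `d · h_d = Σ_t W_t(d)` (since `Σ_t μ_t = d` on the degree-`d` slice). -/
theorem natCast_mul_hsum (z : Fin N → ℂ) (d : ℕ) : (d : ℂ) * hsum z d = ∑ t, wsum z t d := by
  unfold hsum wsum
  rw [Finset.sum_comm, Finset.mul_sum]
  refine Finset.sum_congr rfl fun μ hμ => ?_
  rw [← Finset.sum_mul]
  congr 1
  rw [Nat.mem_antidiagonalTuple] at hμ
  exact_mod_cast hμ.symm

/-- The product `z^μ` with one exponent lowered: `z^μ = z_t · z^{μ - e_t}` when `μ_t ≥ 1`. -/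
theorem mono_eq_mul_update (z : Fin N → ℂ) (μ : Fin N → ℕ) (t : Fin N) (h : 1 ≤ μ t) :
    mono z μ = z t * mono z (Function.update μ t (μ t - 1)) := by
  unfold mono
  rw [← Finset.mul_prod_erase Finset.univ (fun s => z s ^ μ s) (Finset.mem_univ t),
    ← Finset.mul_prod_erase Finset.univ (fun s => z s ^ Function.update μ t (μ t - 1) s)
      (Finset.mem_univ t)]
  have he : ∏ s ∈ Finset.univ.erase t, z s ^ Function.update μ t (μ t - 1) s =
      ∏ s ∈ Finset.univ.erase t, z s ^ μ s := by
    refine Finset.prod_congr rfl fun s hs => ?_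
    rw [Function.update_of_ne (Finset.ne_of_mem_erase hs)]
  simp only [Function.update_self]
  rw [he, ← mul_assoc, ← pow_succ']
  congr 2
  omega

/-- KEY RECURSION: `W_t(d+1) = z_t · (h_d + W_t(d))`. -/
theorem wsum_succ (z : Fin N → ℂ) (t : Fin N) (d : ℕ) :
    wsum z t (d + 1) = z t * (hsum z d + wsum z t d) := by
  classical
  have hR : z t * (hsum z d + wsum z t d) =
      ∑ ν ∈ Nat.antidiagonalTuple N d, ((ν t : ℂ) + 1) * (z t * mono z ν) := by
    unfold hsum wsum
    rw [← Finset.sum_add_distrib, Finset.mul_sum]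
    exact Finset.sum_congr rfl fun ν _ => by ring
  rw [hR]
  unfold wsum
  rw [← Finset.sum_filter_add_sum_filter_not (Nat.antidiagonalTuple N (d + 1)) (fun μ => μ t = 0)]
  have h0 : ∑ μ ∈ (Nat.antidiagonalTuple N (d + 1)).filter (fun μ => μ t = 0),
      (μ t : ℂ) * mono z μ = 0 := by
    refine Finset.sum_eq_zero fun μ hμ => ?_
    rw [(Finset.mem_filter.mp hμ).2]
    simp
  rw [h0, zero_add]
  refine Finset.sum_nbij' (fun μ => Function.update μ t (μ t - 1))
    (fun ν => Function.update ν t (ν t + 1)) ?_ ?_ ?_ ?_ ?_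
  · intro μ hμ
    rw [Finset.mem_filter, Nat.mem_antidiagonalTuple] at hμ
    rw [Nat.mem_antidiagonalTuple, Finset.sum_update_of_mem (Finset.mem_univ t),
      Finset.sdiff_singleton_eq_erase]
    have := Finset.add_sum_erase Finset.univ μ (Finset.mem_univ t)
    omega
  · intro ν hν
    rw [Nat.mem_antidiagonalTuple] at hν
    rw [Finset.mem_filter, Nat.mem_antidiagonalTuple,
      Finset.sum_update_of_mem (Finset.mem_univ t), Finset.sdiff_singleton_eq_erase]
    have := Finset.add_sum_erase Finset.univ ν (Finset.mem_univ t)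
    refine ⟨by omega, ?_⟩
    simp
  · intro μ hμ
    rw [Finset.mem_filter] at hμ
    rw [Function.update_self, Function.update_idem]
    have h1 : μ t - 1 + 1 = μ t := by have := hμ.2; omega
    rw [h1, Function.update_eq_self]
  · intro ν _
    rw [Function.update_self, Function.update_idem, Nat.add_sub_cancel, Function.update_eq_self]
  · intro μ hμ
    rw [Finset.mem_filter] at hμ
    have hμt : 1 ≤ μ t := Nat.one_le_iff_ne_zero.mpr hμ.2
    rw [Function.update_self, mono_eq_mul_update z μ t hμt]
    push_cast [Nat.cast_sub hμt]
    ring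

/-- Closed form: `W_t(d) = Σ_{i<d} z_t^{i+1} · h_{d-1-i}`. -/
theorem wsum_eq (z : Fin N → ℂ) (t : Fin N) :
    ∀ d, wsum z t d = ∑ i ∈ range d, z t ^ (i + 1) * hsum z (d - 1 - i)
  | 0 => by simp [wsum_zero]
  | d + 1 => by
    rw [wsum_succ, wsum_eq z t d, Finset.sum_range_succ', mul_add, Finset.mul_sum, add_comm]
    congr 1
    · refine Finset.sum_congr rfl fun i hi => ?_
      have hi' := Finset.mem_range.mp hi
      rw [← mul_assoc, ← pow_succ']
      congr 2
      omega
    · simp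

/-- NEWTON'S IDENTITY for complete homogeneous sums: `d · h_d = Σ_{i<d} P_{i+1} · h_{d-1-i}`. -/
theorem newton (z : Fin N → ℂ) (d : ℕ) :
    (d : ℂ) * hsum z d = ∑ i ∈ range d, psum z (i + 1) * hsum z (d - 1 - i) := by
  rw [natCast_mul_hsum]
  simp_rw [wsum_eq]
  rw [Finset.sum_comm]
  refine Finset.sum_congr rfl fun i _ => ?_
  rw [psum, Finset.sum_mul]

/-- Hockey stick in the form needed: `Σ_{j ≤ d} C(K+j-1, j) = C(K+d, d)`. -/
theorem sum_range_choose_hockey (K d : ℕ) :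
    ∑ j ∈ range (d + 1), (K + j - 1).choose j = (K + d).choose d := by
  rcases K with _ | k
  · rw [Finset.sum_range_succ']
    have h : ∀ i ∈ range d, (0 + (i + 1) - 1).choose (i + 1) = 0 := by
      intro i _
      rw [show 0 + (i + 1) - 1 = i by omega]
      exact Nat.choose_succ_self i
    rw [Finset.sum_congr rfl h]
    simp
  · have h1 : ∀ j, (k + 1 + j - 1).choose j = (j + k).choose k := by
      intro j
      rw [show k + 1 + j - 1 = j + k by omega]
      exact Nat.choose_symm_add
    simp_rw [h1]
    rw [Nat.sum_range_add_choose, show d + k + 1 = (k + 1) + d by omega]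
    exact Nat.choose_symm_add

/-- THE BOUND: uniform power-sum bounds `‖P_i‖ ≤ K (1 ≤ i ≤ d)` give `‖h_d‖ ≤ C(K+d-1, d)`. -/
theorem norm_hsum_le (z : Fin N → ℂ) (K : ℕ) :
    ∀ d, (∀ i, 1 ≤ i → i ≤ d → ‖psum z i‖ ≤ K) → ‖hsum z d‖ ≤ ((K + d - 1).choose d : ℝ) := by
  intro d
  induction d using Nat.strong_induction_on with
  | _ d ih =>
    intro hP
    rcases d with _ | d
    · simp [hsum_zero]
    · have key : (((d + 1 : ℕ) : ℝ)) * ‖hsum z (d + 1)‖ ≤ (K : ℝ) * ((K + d).choose d : ℝ) := by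
        have h1 : ‖((d + 1 : ℕ) : ℂ) * hsum z (d + 1)‖ = ((d + 1 : ℕ) : ℝ) * ‖hsum z (d + 1)‖ := by
          rw [norm_mul, Complex.norm_natCast]
        rw [← h1, newton]
        calc ‖∑ i ∈ range (d + 1), psum z (i + 1) * hsum z (d + 1 - 1 - i)‖
            ≤ ∑ i ∈ range (d + 1), ‖psum z (i + 1) * hsum z (d + 1 - 1 - i)‖ := norm_sum_le _ _
          _ ≤ ∑ i ∈ range (d + 1), (K : ℝ) * (((K + (d - i) - 1).choose (d - i) : ℕ) : ℝ) := by
              refine Finset.sum_le_sum fun i hi => ?_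
              have hi' := Finset.mem_range.mp hi
              rw [norm_mul, show d + 1 - 1 - i = d - i by omega]
              exact mul_le_mul (hP (i + 1) (by omega) (by omega))
                (ih (d - i) (by omega) fun j hj hj' => hP j hj (by omega))
                (norm_nonneg _) (Nat.cast_nonneg _)
          _ = (K : ℝ) * ∑ i ∈ range (d + 1), (((K + (d - i) - 1).choose (d - i) : ℕ) : ℝ) := by
              rw [Finset.mul_sum]
          _ = (K : ℝ) * ((K + d).choose d : ℝ) := by
              congr 1
              have hrefl := Finset.sum_range_reflect (fun j => (((K + j - 1).choose j : ℕ) : ℝ)) (d + 1)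
              simp only [show ∀ j, d + 1 - 1 - j = d - j from fun j => by omega] at hrefl
              rw [hrefl]
              exact_mod_cast sum_range_choose_hockey K d
      have hnat : (K + d).choose (d + 1) * (d + 1) = (K + d).choose d * K := by
        have := Nat.choose_succ_right_eq (K + d) d
        simpa using this
      rw [show K + (d + 1) - 1 = K + d by omega]
      have h2 : ((d + 1 : ℕ) : ℝ) * ‖hsum z (d + 1)‖ ≤
          (((K + d).choose (d + 1) : ℕ) : ℝ) * ((d + 1 : ℕ) : ℝ) := by
        calc _ ≤ (K : ℝ) * ((K + d).choose d : ℝ) := key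
          _ = _ := by rw [mul_comm]; exact_mod_cast hnat.symm
      have hpos : (0 : ℝ) < ((d + 1 : ℕ) : ℝ) := by positivity
      nlinarith [h2, hpos, norm_nonneg (hsum z (d + 1))]

/-- Sum over all degrees `≤ n`: `‖Σ_{d ≤ n} h_d‖ ≤ C(K+n, n)`. -/
theorem norm_sum_hsum_le (z : Fin N → ℂ) (K n : ℕ)
    (hP : ∀ i, 1 ≤ i → i ≤ n → ‖psum z i‖ ≤ K) :
    ‖∑ d ∈ range (n + 1), hsum z d‖ ≤ ((K + n).choose n : ℝ) := by
  calc ‖∑ d ∈ range (n + 1), hsum z d‖ ≤ ∑ d ∈ range (n + 1), ‖hsum z d‖ := norm_sum_le _ _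
    _ ≤ ∑ d ∈ range (n + 1), (((K + d - 1).choose d : ℕ) : ℝ) :=
        Finset.sum_le_sum fun d hd => norm_hsum_le z K d fun i hi hi' =>
          hP i hi (by have := Finset.mem_range.mp hd; omega)
    _ = ((K + n).choose n : ℝ) := by exact_mod_cast sum_range_choose_hockey K n

/-- The simplex `{μ : Fin N → ℕ | Σ μ ≤ n}` as a Finset. -/
def simplex (N n : ℕ) : Finset (Fin N → ℕ) := (range (n + 1)).biUnion (Nat.antidiagonalTuple N)

/-- Membership in the simplex: `μ ∈ simplex N n ↔ Σ μ ≤ n`. -/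
theorem mem_simplex {n : ℕ} {μ : Fin N → ℕ} : μ ∈ simplex N n ↔ ∑ i, μ i ≤ n := by
  unfold simplex
  rw [Finset.mem_biUnion]
  constructor
  · rintro ⟨d, hd, hμ⟩
    rw [Nat.mem_antidiagonalTuple] at hμ
    have := Finset.mem_range.mp hd
    omega
  · intro h
    exact ⟨∑ i, μ i, Finset.mem_range.mpr (by omega), Nat.mem_antidiagonalTuple.mpr rfl⟩

/-- The sum of `z^μ` over the simplex is the sum of the complete homogeneous sums `h_d`, `d ≤ n`. -/
theorem sum_simplex_mono (z : Fin N → ℂ) (n : ℕ) :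
    ∑ μ ∈ simplex N n, mono z μ = ∑ d ∈ range (n + 1), hsum z d := by
  unfold simplex hsum
  rw [Finset.sum_biUnion]
  intro d₁ _ d₂ _ hne
  simp only [Function.onFun]
  rw [Finset.disjoint_left]
  intro μ h1 h2
  rw [Nat.mem_antidiagonalTuple] at h1 h2
  exact hne (h1 ▸ h2)

/-- **SIMPLEX CHARACTER-SUM BOUND (memo §4c (d)).** If the power sums satisfy `‖Σ_t z_t^i‖ ≤ K` for
`1 ≤ i ≤ n`, then `‖Σ_{μ : Σμ ≤ n} Π_t z_t^{μ_t}‖ ≤ C(K+n, n)`. With `K = ⌈p^{-δ} n⌉` from Bourgain's theorem this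
is `exp(o(n))`, against the diagonal Gram entry `|simplex| = C(N+n, n)`. -/
theorem norm_sum_simplex_le (z : Fin N → ℂ) (K n : ℕ)
    (hP : ∀ i, 1 ≤ i → i ≤ n → ‖∑ t, z t ^ i‖ ≤ K) :
    ‖∑ μ ∈ simplex N n, ∏ t, z t ^ μ t‖ ≤ ((K + n).choose n : ℝ) := by
  have h := norm_sum_hsum_le z K n hP
  rw [← sum_simplex_mono] at h
  exact h

section Gershgorin

variable {I X : Type*} [Fintype X]

open scoped ComplexConjugate

/-- Gram entries of a family of functions `f α : X → ℂ` for the standard Hermitian inner product. -/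
noncomputable def gram (f : I → X → ℂ) (α β : I) : ℂ := ∑ x, conj (f α x) * f β x

/-- The diagonal Gram entry is the squared `ℓ²` norm. -/
theorem gram_self (f : I → X → ℂ) (α : I) : gram f α α = ((∑ x, ‖f α x‖ ^ 2 : ℝ) : ℂ) := by
  unfold gram
  push_cast
  exact Finset.sum_congr rfl fun x _ => Complex.conj_mul' _

/-- **Gershgorin for Gram matrices**: strict diagonal dominance ⇒ linear independence (memo §4c (c)). -/
theorem linearIndependent_of_gram_dominant [Fintype I] [DecidableEq I] (f : I → X → ℂ)
    (h : ∀ α, ∑ β ∈ Finset.univ.erase α, ‖gram f α β‖ < ∑ x, ‖f α x‖ ^ 2) :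
    LinearIndependent ℂ f := by
  rw [linearIndependent_iff']
  intro s g hg i hi
  obtain ⟨α, hαs, hmax⟩ := Finset.exists_max_image s (fun j => ‖g j‖) ⟨i, hi⟩
  by_contra hne
  have hgα : 0 < ‖g α‖ := lt_of_lt_of_le (norm_pos_iff.mpr hne) (hmax i hi)
  have hx : ∀ x, ∑ β ∈ s, g β * f β x = 0 := by
    intro x
    have := congrFun hg x
    simpa [Finset.sum_apply, Pi.smul_apply, smul_eq_mul] using this
  have rel : ∑ β ∈ s, g β * gram f α β = 0 := by
    simp_rw [gram, Finset.mul_sum]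
    rw [Finset.sum_comm]
    refine Finset.sum_eq_zero fun x _ => ?_
    have h2 : ∑ β ∈ s, g β * (conj (f α x) * f β x) = conj (f α x) * ∑ β ∈ s, g β * f β x := by
      rw [Finset.mul_sum]
      exact Finset.sum_congr rfl fun β _ => by ring
    rw [h2, hx x, mul_zero]
  rw [← Finset.add_sum_erase s _ hαs] at rel
  have eq1 : g α * gram f α α = -∑ β ∈ s.erase α, g β * gram f α β :=
    eq_neg_of_add_eq_zero_left rel
  have hdiag : ‖gram f α α‖ = ∑ x, ‖f α x‖ ^ 2 := by
    rw [gram_self, Complex.norm_real,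
      Real.norm_of_nonneg (Finset.sum_nonneg fun x _ => by positivity)]
  have key : ‖g α‖ * ∑ x, ‖f α x‖ ^ 2 ≤ ‖g α‖ * ∑ β ∈ Finset.univ.erase α, ‖gram f α β‖ := by
    calc ‖g α‖ * ∑ x, ‖f α x‖ ^ 2 = ‖g α * gram f α α‖ := by rw [norm_mul, hdiag]
      _ = ‖∑ β ∈ s.erase α, g β * gram f α β‖ := by rw [eq1, norm_neg]
      _ ≤ ∑ β ∈ s.erase α, ‖g β * gram f α β‖ := norm_sum_le _ _
      _ ≤ ∑ β ∈ s.erase α, ‖g α‖ * ‖gram f α β‖ := Finset.sum_le_sum fun β hβ => by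
          rw [norm_mul]
          exact mul_le_mul_of_nonneg_right (hmax β (Finset.mem_of_mem_erase hβ)) (norm_nonneg _)
      _ ≤ ∑ β ∈ Finset.univ.erase α, ‖g α‖ * ‖gram f α β‖ :=
          Finset.sum_le_sum_of_subset_of_nonneg
            (Finset.erase_subset_erase _ (Finset.subset_univ s)) fun β _ _ => by positivity
      _ = ‖g α‖ * ∑ β ∈ Finset.univ.erase α, ‖gram f α β‖ := by rw [Finset.mul_sum]
  have hα := h α
  nlinarith [key, hα, hgα]

end Gershgorin

section Characters

variable {p : ℕ} [NeZero p]

open scoped ComplexConjugate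

/-- The standard additive character of `ZMod p` (`j ↦ exp(2πi j/p)`). -/
noncomputable abbrev ψ : AddChar (ZMod p) ℂ := ZMod.stdAddChar

/-- `χ_e(μ) = Π_t ψ(e_t)^{μ_t} = ψ(Σ_t μ_t e_t)`: the character with exponent vector `e` on `μ`. -/
noncomputable def chi (e : Fin N → ZMod p) (μ : Fin N → ℕ) : ℂ := ∏ t, (ψ (e t)) ^ μ t

/-- Values of the standard additive character are nonzero. -/
theorem stdAddChar_ne_zero (a : ZMod p) : (ψ a : ℂ) ≠ 0 := by
  intro h0
  have := AddChar.norm_apply (ψ : AddChar (ZMod p) ℂ) a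
  rw [h0, norm_zero] at this
  exact zero_ne_one this

/-- `conj ψ(a) = ψ(-a)` (values are unimodular). -/
theorem conj_stdAddChar (a : ZMod p) : conj (ψ a : ℂ) = ψ (-a) := by
  have h1 : conj (ψ a : ℂ) * ψ a = 1 := by
    rw [Complex.conj_mul', AddChar.norm_apply]
    simp
  have h2 : (ψ (-a) : ℂ) * ψ a = 1 := by
    rw [← AddChar.map_add_eq_mul, neg_add_cancel, AddChar.map_zero_eq_one]
  exact mul_right_cancel₀ (stdAddChar_ne_zero a) (h1.trans h2.symm)

/-- `conj χ_e(μ) · χ_{e'}(μ) = Π_t ψ(e'_t - e_t)^{μ_t}`. -/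
theorem conj_chi_mul_chi (e e' : Fin N → ZMod p) (μ : Fin N → ℕ) :
    conj (chi e μ) * chi e' μ = mono (fun t => ψ (e' t - e t)) μ := by
  unfold chi mono
  rw [map_prod, ← Finset.prod_mul_distrib]
  refine Finset.prod_congr rfl fun t _ => ?_
  rw [map_pow, ← mul_pow, conj_stdAddChar, ← AddChar.map_add_eq_mul]
  simp only [sub_eq_add_neg, add_comm]

/-- Characters are unimodular: `‖χ_e(μ)‖ = 1`. -/
theorem norm_chi (e : Fin N → ZMod p) (μ : Fin N → ℕ) : ‖chi e μ‖ = 1 := by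
  unfold chi
  rw [norm_prod]
  exact Finset.prod_eq_one fun t _ => by rw [norm_pow, AddChar.norm_apply, one_pow]

/-- The `i`-th power sum of `(ψ(e_t))_t` is the character sum `Σ_t ψ(i e_t)`. -/
theorem psum_stdAddChar (e : Fin N → ZMod p) (i : ℕ) :
    ∑ t, (ψ (e t) : ℂ) ^ i = ∑ t, ψ ((i : ZMod p) * e t) :=
  Finset.sum_congr rfl fun t _ => by rw [← AddChar.map_nsmul_eq_pow, nsmul_eq_mul]

/-- **CHARACTER INDEPENDENCE ON THE SIMPLEX FROM UNIFORM CANCELLATION (memo §4c, steps (c)+(d)).**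
Let `E α : Fin N → ZMod p` (`α ∈ I`) be exponent vectors. If for every pair `α ≠ β` the power sums of the
difference, `Σ_t ψ(i·(E β t − E α t))`, have norm `≤ K` for `1 ≤ i ≤ n`, and `(|I| − 1)·C(K+n, n) < |simplex|`,
then the characters `μ ↦ χ_{E α}(μ)` are linearly independent as functions on the simplex `{Σ μ ≤ n}`.
(For KRST: `E (a,λ) t = λ·a^t`, `N = n`, `|I| = |A|(p−1)+1`, `K = ⌈p^{−δ} n⌉` from Bourgain 2005 Thm 2.) -/
theorem linearIndependent_chi {I : Type*} [Fintype I] [DecidableEq I] (E : I → Fin N → ZMod p)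
    (n K : ℕ)
    (hK : ∀ α β, α ≠ β → ∀ i, 1 ≤ i → i ≤ n →
      ‖∑ t, (ψ ((i : ZMod p) * (E β t - E α t)) : ℂ)‖ ≤ K)
    (hdom : ((Fintype.card I - 1 : ℕ) : ℝ) * ((K + n).choose n : ℝ) < (simplex N n).card) :
    LinearIndependent ℂ (fun α (μ : simplex N n) => chi (E α) (μ : Fin N → ℕ)) := by
  apply linearIndependent_of_gram_dominant
  intro α
  have hdiag : ∑ μ : simplex N n, ‖chi (E α) (μ : Fin N → ℕ)‖ ^ 2 = ((simplex N n).card : ℝ) := by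
    simp [norm_chi]
  rw [hdiag]
  have hoff : ∀ β ∈ Finset.univ.erase α,
      ‖gram (fun α (μ : simplex N n) => chi (E α) (μ : Fin N → ℕ)) α β‖ ≤ ((K + n).choose n : ℝ) := by
    intro β hβ
    have hne : α ≠ β := (Finset.ne_of_mem_erase hβ).symm
    unfold gram
    simp_rw [conj_chi_mul_chi]
    rw [Finset.sum_coe_sort (simplex N n) (fun μ => mono (fun t => ψ (E β t - E α t)) μ)]
    unfold mono
    refine norm_sum_simplex_le _ K n fun i hi hi' => ?_
    rw [psum_stdAddChar]
    exact hK α β hne i hi hi'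
  calc ∑ β ∈ Finset.univ.erase α, ‖gram (fun α (μ : simplex N n) => chi (E α) (μ : Fin N → ℕ)) α β‖
      ≤ ∑ β ∈ Finset.univ.erase α, ((K + n).choose n : ℝ) := Finset.sum_le_sum hoff
    _ = ((Fintype.card I - 1 : ℕ) : ℝ) * ((K + n).choose n : ℝ) := by
        rw [Finset.sum_const, Finset.card_erase_of_mem (Finset.mem_univ α), Finset.card_univ,
          nsmul_eq_mul]
    _ < _ := hdom

end Characters
end Summit.ValiantsHypothesis.ValiantsHypothesis.Theorems.BarrierLever.KRSTNoGoBelow12cOnB05.CharSum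

end
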